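import Mathlib
import Literature.MathematicalPhysics.KineticTheory.InfiniteChainInvariantStates
import Literature.MathematicalPhysics.KineticTheory.InfiniteChainObservables
import Literature.MathematicalPhysics.KineticTheory.InfiniteChainVariationalCalculus

/-!
# BC5 special case for piece 2 of the split of `BoundedOddRigidity` (stmt-AtomisticToContinuum-11027)

`OddLawOfCurrentAsymmetry` at the HARMONIC member `pinnedChain ω₂ 0 0 γ` is a THEOREM (no sorry):
the witness `f = p_0 (q_1 - q_{-1})` is a smooth local density, odd under `R : p ↦ -p`, a local
conservation law `𝒜f = ψ - ψ∘τ` with `ψ = -(p_{-1}p_0 + q_{-1}² + q_0² - (2+ω₂) q_{-1} q_0)`, and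
not a shift-coboundary (it sums to `1 ≠ 0` over a period of an explicit 3-periodic configuration,
whereas every coboundary telescopes to `0`). This is exactly the regime where the crux itself is
FALSE (Spohn–Lebowitz 1977 current-carrying Gaussian stationary states), so piece 2 is provably
not the crux in costume.
-/

noncomputable section

open Literature.MathematicalPhysics.KineticTheory.HeatConduction

namespace Summit.AtomisticToContinuum.FouriersLaw.Cruxes.BoundedOddRigidity.Strategist

/-- coordinate functionals on the box `Fin 3 → ℝ × ℝ` -/
def qL (i : Fin 3) : (Fin 3 → ℝ × ℝ) →L[ℝ] ℝ :=
  (ContinuousLinearMap.fst ℝ ℝ ℝ).comp (ContinuousLinearMap.proj i)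
def pL (i : Fin 3) : (Fin 3 → ℝ × ℝ) →L[ℝ] ℝ :=
  (ContinuousLinearMap.snd ℝ ℝ ℝ).comp (ContinuousLinearMap.proj i)

@[simp] theorem qL_apply (i : Fin 3) (y : Fin 3 → ℝ × ℝ) : qL i y = (y i).1 := rfl
@[simp] theorem pL_apply (i : Fin 3) (y : Fin 3 → ℝ × ℝ) : pL i y = (y i).2 := rfl

/-- the box representative of the witness: `g(y) = p(y_1) (q(y_2) - q(y_0))` (box sites -1,0,1 ↦ 0,1,2) -/
def gw : (Fin 3 → ℝ × ℝ) → ℝ := fun y => pL 1 y * (qL 2 - qL 0) y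

theorem gw_hasFDerivAt (y : Fin 3 → ℝ × ℝ) :
    HasFDerivAt gw ((pL 1 y) • (qL 2 - qL 0) + ((qL 2 - qL 0) y) • pL 1) y := by
  have h1 : HasFDerivAt (fun y => pL 1 y) (pL 1) y := (pL 1).hasFDerivAt
  have h2 : HasFDerivAt (fun y => (qL 2 - qL 0) y) (qL 2 - qL 0) y := (qL 2 - qL 0).hasFDerivAt
  exact h1.mul h2

theorem gw_contDiff : ContDiff ℝ ((⊤ : ℕ∞) : WithTop ℕ∞) gw :=
  (pL 1).contDiff.mul (qL 2 - qL 0).contDiff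

/-- the witness `f = p_0 (q_1 - q_{-1})` -/
def wit : ChainConfig → ℝ := gw ∘ boxRestrict 1

theorem wit_apply (σ : ChainConfig) : wit σ = (σ 0).2 * ((σ 1).1 - (σ (-1)).1) := by
  simp [wit, gw, boxRestrict]

/-- the flux representative: `ψ = -(p_{-1}p_0 + q_{-1}² + q_0² - (2+ω₂) q_{-1} q_0)` -/
def gψ (ω₂ : ℝ) : (Fin 3 → ℝ × ℝ) → ℝ := fun y =>
  -(pL 0 y * pL 1 y + qL 0 y * qL 0 y + qL 1 y * qL 1 y - (2 + ω₂) * (qL 0 y * qL 1 y))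

theorem gψ_contDiff (ω₂ : ℝ) : ContDiff ℝ ((⊤ : ℕ∞) : WithTop ℕ∞) (gψ ω₂) := by
  unfold gψ
  apply ContDiff.neg
  apply ContDiff.sub
  · exact (((pL 0).contDiff.mul (pL 1).contDiff).add ((qL 0).contDiff.mul (qL 0).contDiff)).add
      ((qL 1).contDiff.mul (qL 1).contDiff)
  · exact contDiff_const.mul ((qL 0).contDiff.mul (qL 1).contDiff)

def ψw (ω₂ : ℝ) : ChainConfig → ℝ := gψ ω₂ ∘ boxRestrict 1

theorem ψw_apply (ω₂ : ℝ) (σ : ChainConfig) :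
    ψw ω₂ σ = -((σ (-1)).2 * (σ 0).2 + (σ (-1)).1 * (σ (-1)).1 + (σ 0).1 * (σ 0).1
      - (2 + ω₂) * ((σ (-1)).1 * (σ 0).1)) := by
  simp [ψw, gψ, boxRestrict]

/-- `𝒜 wit` computed through the finite box sum. -/
theorem liouvilleZ_wit (ω₂ γ : ℝ) (σ : ChainConfig) :
    liouvilleZ (pinnedChain ω₂ 0 0 γ) wit σ =
      (σ 0).2 * (σ 1).2 - (σ (-1)).2 * (σ 0).2 +
        (-(ω₂ * (σ 0).1) + ((σ 1).1 - (σ 0).1) - ((σ 0).1 - (σ (-1)).1)) * ((σ 1).1 - (σ (-1)).1) := by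
  have hd : DifferentiableAt ℝ gw (boxRestrict 1 σ) := (gw_hasFDerivAt _).differentiableAt
  rw [wit, liouvilleZ_comp_boxRestrict (pinnedChain ω₂ 0 0 γ) 1 σ hd, (gw_hasFDerivAt _).fderiv]
  have hF : (pinnedChain ω₂ 0 0 γ).force σ 0 =
      -(ω₂ * (σ 0).1) + ((σ 1).1 - (σ 0).1) - ((σ 0).1 - (σ (-1)).1) := by
    rw [OscillatorChain.force_eq, pinnedChain_deriv_U_eq, pinnedChain_deriv_V_eq]
    norm_num
  simp [Fin.sum_univ_three, boxRestrict, Pi.single_apply, hF]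
  ring

/-- the conservation law `𝒜 wit = ψ - ψ∘τ`. -/
theorem conservation (ω₂ γ : ℝ) (σ : ChainConfig) :
    liouvilleZ (pinnedChain ω₂ 0 0 γ) wit σ = ψw ω₂ σ - ψw ω₂ (shift σ) := by
  rw [liouvilleZ_wit, ψw_apply, ψw_apply]
  simp only [shift]
  norm_num
  ring

/-- a 3-periodic configuration on which `wit` sums to `1` over a period. -/
def σ3 : ChainConfig := fun x => if x % 3 = 0 then (0, 1) else if x % 3 = 1 then (1, 0) else (0, 0)

theorem shift3_σ3 : shift (shift (shift σ3)) = σ3 := by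
  funext x
  simp only [shift, σ3]
  have h : (x + 1 + 1 + 1) % 3 = x % 3 := by omega
  rw [h]

theorem wit_σ3_sum : wit σ3 + wit (shift σ3) + wit (shift (shift σ3)) = 1 := by
  simp [wit_apply, shift, σ3]

/-- `wit` is not a shift-coboundary of ANY function. -/
theorem wit_not_coboundary (h : ChainConfig → ℝ) (hh : ∀ σ, wit σ = h σ - h (shift σ)) : False := by
  have hsum := wit_σ3_sum
  rw [hh σ3, hh (shift σ3), hh (shift (shift σ3)), shift3_σ3] at hsum
  linarith

/-- **BC5 special case.** Piece 2 of the split (`OddLawOfCurrentAsymmetry`) HOLDS at the harmonic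
member `lam = β = 0` (every `ω₂ γ`), by the explicit witness `p_0 (q_1 - q_{-1})`. -/
theorem oddLawOfCurrentAsymmetry_harmonic (ω₂ γ : ℝ) :
    ∀ ν : MeasureTheory.Measure ChainConfig, MeasureTheory.IsProbabilityMeasure ν →
      IsShiftInvariant ν → IsTimeInvariant (pinnedChain ω₂ 0 0 γ) ν →
      IsRegular (pinnedChain ω₂ 0 0 γ) ν → ∀ M : ℝ, 0 < M →
      ∫ σ, max (-M) (min M ((pinnedChain ω₂ 0 0 γ).bondCurrentZ σ 0)) ∂ν ≠ 0 →
      ∃ f : ChainConfig → ℝ,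
        (∃ (R : ℕ) (g : (Fin (2 * R + 1) → ℝ × ℝ) → ℝ), ContDiff ℝ ((⊤ : ℕ∞) : WithTop ℕ∞) g ∧
          f = g ∘ boxRestrict R) ∧
        (∀ σ : ChainConfig, f (fun x => ((σ x).1, -(σ x).2)) = -f σ) ∧
        (∃ ψ : ChainConfig → ℝ,
          (∃ (R : ℕ) (g : (Fin (2 * R + 1) → ℝ × ℝ) → ℝ), ContDiff ℝ ((⊤ : ℕ∞) : WithTop ℕ∞) g ∧
            ψ = g ∘ boxRestrict R) ∧
          ∀ σ, liouvilleZ (pinnedChain ω₂ 0 0 γ) f σ = ψ σ - ψ (shift σ)) ∧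
        ¬ ∃ h : ChainConfig → ℝ,
          (∃ (R : ℕ) (g : (Fin (2 * R + 1) → ℝ × ℝ) → ℝ), ContDiff ℝ ((⊤ : ℕ∞) : WithTop ℕ∞) g ∧
            h = g ∘ boxRestrict R) ∧
          ∀ σ, f σ = h σ - h (shift σ) := by
  intro ν _ _ _ _ M _ _
  refine ⟨wit, ⟨1, gw, gw_contDiff, rfl⟩, ?_, ⟨ψw ω₂, ⟨1, gψ ω₂, gψ_contDiff ω₂, rfl⟩,
    conservation ω₂ γ⟩, ?_⟩
  · intro σ
    rw [wit_apply, wit_apply]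
    ring
  · rintro ⟨h, -, hh⟩
    exact wit_not_coboundary h hh

/-! ### Wiring: the special case is literally the instance `lam = β = 0` of piece 2 -/

/-- piece 2 of the split, verbatim (as filed). -/
def OddLawOfCurrentAsymmetry : Prop :=
  ∀ ω₂ lam β γ : ℝ, ∀ ν : MeasureTheory.Measure Literature.MathematicalPhysics.KineticTheory.HeatConduction.ChainConfig, MeasureTheory.IsProbabilityMeasure ν → Literature.MathematicalPhysics.KineticTheory.HeatConduction.IsShiftInvariant ν → Literature.MathematicalPhysics.KineticTheory.HeatConduction.IsTimeInvariant (Literature.MathematicalPhysics.KineticTheory.HeatConduction.pinnedChain ω₂ lam β γ) ν → Literature.MathematicalPhysics.KineticTheory.HeatConduction.IsRegular (Literature.MathematicalPhysics.KineticTheory.HeatConduction.pinnedChain ω₂ lam β γ) ν → ∀ M : ℝ, 0 < M → ∫ σ, max (-M) (min M ((Literature.MathematicalPhysics.KineticTheory.HeatConduction.pinnedChain ω₂ lam β γ).bondCurrentZ σ 0)) ∂ν ≠ 0 → ∃ f : Literature.MathematicalPhysics.KineticTheory.HeatConduction.ChainConfig → ℝ, (∃ (R : ℕ) (g : (Fin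 (2 * R + 1) → ℝ × ℝ) → ℝ), ContDiff ℝ ((⊤ : ℕ∞) : WithTop ℕ∞) g ∧ f = g ∘ Literature.MathematicalPhysics.KineticTheory.HeatConduction.boxRestrict R) ∧ (∀ σ : Literature.MathematicalPhysics.KineticTheory.HeatConduction.ChainConfig, f (fun x => ((σ x).1, -(σ x).2)) = -f σ) ∧ (∃ ψ : Literature.MathematicalPhysics.KineticTheory.HeatConduction.ChainConfig → ℝ, (∃ (R : ℕ) (g : (Fin (2 * R + 1) → ℝ × ℝ) → ℝ), ContDiff ℝ ((⊤ : ℕ∞) : WithTop ℕ∞) g ∧ ψ = g ∘ Literature.MathematicalPhysics.KineticTheory.HeatConduction.boxRestrict R) ∧ ∀ σ, Literature.MathematicalPhysics.KineticTheory.HeatConduction.liouvilleZ (Literature.MathematicalPhysics.KineticTheory.HeatConduction.pinnedChain ω₂ lam β γ) f σ = ψ σ - ψ (Literature.MathematicalPhysics.KineticTheory.HeatConduction.shift σ)) ∧ ¬ ∃ h : Literature.MathematicalPhysics.KineticTheory.HeatConduction.ChainConfig → ℝ, (∃ (R : ℕ) (g : (Fin (2 * R + 1) → ℝ × ℝ)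 → ℝ), ContDiff ℝ ((⊤ : ℕ∞) : WithTop ℕ∞) g ∧ h = g ∘ Literature.MathematicalPhysics.KineticTheory.HeatConduction.boxRestrict R) ∧ ∀ σ, f σ = h σ - h (Literature.MathematicalPhysics.KineticTheory.HeatConduction.shift σ)

/-- piece 2 at fixed parameters. -/
def OddLawAt (ω₂ lam β γ : ℝ) : Prop :=
  ∀ ν : MeasureTheory.Measure Literature.MathematicalPhysics.KineticTheory.HeatConduction.ChainConfig, MeasureTheory.IsProbabilityMeasure ν → Literature.MathematicalPhysics.KineticTheory.HeatConduction.IsShiftInvariant ν → Literature.MathematicalPhysics.KineticTheory.HeatConduction.IsTimeInvariant (Literature.MathematicalPhysics.KineticTheory.HeatConduction.pinnedChain ω₂ lam β γ) ν → Literature.MathematicalPhysics.KineticTheory.HeatConduction.IsRegular (Literature.MathematicalPhysics.KineticTheory.HeatConduction.pinnedChain ω₂ lam β γ) ν → ∀ M : ℝ, 0 < M → ∫ σ, max (-M) (min M ((Literature.MathematicalPhysics.KineticTheory.HeatConduction.pinnedChain ω₂ lam β γ).bondCurrentZ σ 0)) ∂ν ≠ 0 → ∃ f : Literature.MathematicalPhysics.KineticTheory.HeatConduction.ChainConfig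 → ℝ, (∃ (R : ℕ) (g : (Fin (2 * R + 1) → ℝ × ℝ) → ℝ), ContDiff ℝ ((⊤ : ℕ∞) : WithTop ℕ∞) g ∧ f = g ∘ Literature.MathematicalPhysics.KineticTheory.HeatConduction.boxRestrict R) ∧ (∀ σ : Literature.MathematicalPhysics.KineticTheory.HeatConduction.ChainConfig, f (fun x => ((σ x).1, -(σ x).2)) = -f σ) ∧ (∃ ψ : Literature.MathematicalPhysics.KineticTheory.HeatConduction.ChainConfig → ℝ, (∃ (R : ℕ) (g : (Fin (2 * R + 1) → ℝ × ℝ) → ℝ), ContDiff ℝ ((⊤ : ℕ∞) : WithTop ℕ∞) g ∧ ψ = g ∘ Literature.MathematicalPhysics.KineticTheory.HeatConduction.boxRestrict R) ∧ ∀ σ, Literature.MathematicalPhysics.KineticTheory.HeatConduction.liouvilleZ (Literature.MathematicalPhysics.KineticTheory.HeatConduction.pinnedChain ω₂ lam β γ) f σ = ψ σ - ψ (Literature.MathematicalPhysics.KineticTheory.HeatConduction.shift σ)) ∧ ¬ ∃ h : Literature.MathematicalPhysics.KineticTheory.HeatConduction.ChainConfig → ℝ, (∃ (R : ℕ) (g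 : (Fin (2 * R + 1) → ℝ × ℝ) → ℝ), ContDiff ℝ ((⊤ : ℕ∞) : WithTop ℕ∞) g ∧ h = g ∘ Literature.MathematicalPhysics.KineticTheory.HeatConduction.boxRestrict R) ∧ ∀ σ, f σ = h σ - h (Literature.MathematicalPhysics.KineticTheory.HeatConduction.shift σ)

theorem oddLawOfCurrentAsymmetry_iff : OddLawOfCurrentAsymmetry ↔ ∀ ω₂ lam β γ : ℝ, OddLawAt ω₂ lam β γ :=
  Iff.rfl

/-- **The harmonic instances of piece 2 are theorems** (where the crux is false). -/
theorem oddLawAt_harmonic (ω₂ γ : ℝ) : OddLawAt ω₂ 0 0 γ :=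
  oddLawOfCurrentAsymmetry_harmonic ω₂ γ

end Summit.AtomisticToContinuum.FouriersLaw.Cruxes.BoundedOddRigidity.Strategist

end
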